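import Summits.ValiantsHypothesis.ValiantsHypothesis.Theses.FeketeSOS

/-!
# `FeketeNoSparseSplit` (crux stmt-ValiantsHypothesis-3997): the PLACE must lie over `p` — even the SIGNED
mod-3 shadow of the line's bound is false (cdisprove cycle 3)

Negative-side load-bearing fact for the line `Cruxes/FeketeNoSparseSplit/Lines/cyclic-valuation-dichotomy.lean`
(refuter-cdisprove-stmt-ValiantsHypothesis-3997-g3-0), PROVED, no new facts; sharpens `Negative/ModTwoShadow.lean`
(cycle 2).  Modulo `2` the Legendre symbol is invisible (`±1 ≡ 1`), so the failure of the mod-2 shadow could be blamed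
on the loss of the signs.  Modulo `3` the signs SURVIVE (`1 ≢ -1`), yet the shadow of the line's bound still fails:
`fekete_nineteen_mod_three_split` — in `𝔽₃[X]`,
`F₁₉ ≡ (X + X⁴ - X⁹ - X¹²)·(1 - X - X² - X⁴ - X⁵ + X⁶)` (over `ℤ` the product is `F₁₉ + 3·(-X⁵ - X⁶ - X⁹ + X¹⁰ + X¹³ + X¹⁴)`),
support-sum `4 + 6 = 10 < 11 = (19+3)/2`, whereas every COMPLEX splitting of `F₁₉` has support-sum `≥ 15` (exhaustive,
item evidence) and the line proves `≥ 11` for all of them.  Hence `not_feketeModThreeShadowBound`.  Cycle-3 data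
(pure python, Cantor–Zassenhaus over `𝔽₃`, minimum over all `𝔽₃`-RATIONAL splittings = products of subsets of the
irreducible factors; `𝔽̄₃`-splittings can only be sparser): below `(p+3)/2` at
`p = 19, 23, 29, 31, 37, 43, 53, 59, 61, 67, 71, 73` (`10<11, 12<13, 13<16, 14<17, 19<20, 21<23, 27<28, 24<31, 30<32,
32<35, 35<37, 36<38`), not below at `p ≤ 17, 41, 47, 79`; over `𝔽₅` and `𝔽₇` no RATIONAL splitting goes below the
bound for `p ≤ 73` (untested over `𝔽̄₅`, `𝔽̄₇`).  So it is not the sign pattern of `χ_p` at some place that carries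
the line, but Euler's criterion `χ_p(m) ≡ m^{(p-1)/2} (mod p)` at the place over `p` itself — consistent with
`FalseWithoutLegendre` (values load-bearing) and `LeverCeiling` (the Legendre target is the lever's extremiser).
-/

namespace Summit.ValiantsHypothesis.Theorems.FeketeNoSparseSplit.Negative

open Polynomial Finset

/-- `19` is prime (local instance). -/
theorem fact_prime_nineteen : Fact (Nat.Prime 19) := ⟨by norm_num⟩

attribute [local instance] fact_prime_nineteen

/-- `F₁₉` reduced modulo `3`, explicitly (quadratic residues mod 19: `1,4,5,6,7,9,11,16,17`). -/
theorem fekete_nineteen_mod_three_eq :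
    (∑ m ∈ Finset.range 19, C ((legendreSym 19 m : ℤ) : ZMod 3) * X ^ m) =
      X - X ^ 2 - X ^ 3 + X ^ 4 + X ^ 5 + X ^ 6 + X ^ 7 - X ^ 8 + X ^ 9 - X ^ 10 + X ^ 11 - X ^ 12 - X ^ 13
        - X ^ 14 - X ^ 15 + X ^ 16 + X ^ 17 - X ^ 18 := by
  simp [Finset.sum_range_succ]
  norm_num
  ring

/-- The 4-term factor `X + X⁴ - X⁹ - X¹²` in injective-exponent form. -/
theorem A19_eq_sum : (X + X ^ 4 - X ^ 9 - X ^ 12 : (ZMod 3)[X]) =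
    ∑ i : Fin 4, C ((![1, 1, -1, -1] : Fin 4 → ZMod 3) i) * X ^ ((![1, 4, 9, 12] : Fin 4 → ℕ) i) := by
  simp [Fin.sum_univ_succ]
  ring

/-- `X + X⁴ - X⁹ - X¹²` has exactly four monomials over `𝔽₃`. -/
theorem card_support_A19 : ((X + X ^ 4 - X ^ 9 - X ^ 12 : (ZMod 3)[X])).support.card = 4 := by
  rw [A19_eq_sum]
  apply card_support_eq'
  · decide
  · intro i; fin_cases i <;> decide

/-- The 6-term factor `1 - X - X² - X⁴ - X⁵ + X⁶` in injective-exponent form. -/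
theorem B19_eq_sum : (1 - X - X ^ 2 - X ^ 4 - X ^ 5 + X ^ 6 : (ZMod 3)[X]) =
    ∑ i : Fin 6, C ((![1, -1, -1, -1, -1, 1] : Fin 6 → ZMod 3) i) * X ^ ((![0, 1, 2, 4, 5, 6] : Fin 6 → ℕ) i) := by
  simp [Fin.sum_univ_succ]
  ring

/-- `1 - X - X² - X⁴ - X⁵ + X⁶` has exactly six monomials over `𝔽₃`. -/
theorem card_support_B19 : ((1 - X - X ^ 2 - X ^ 4 - X ^ 5 + X ^ 6 : (ZMod 3)[X])).support.card = 6 := by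
  rw [B19_eq_sum]
  apply card_support_eq'
  · decide
  · intro i; fin_cases i <;> decide

/-- **The mod-3 splitting at `p = 19`**: `F₁₉ ≡ (X + X⁴ - X⁹ - X¹²)·(1 - X - X² - X⁴ - X⁵ + X⁶) (mod 3)`,
support-sum `10 < 11 = (19+3)/2`.  (Over `ℤ` the product exceeds `F₁₉` by `3·(-X⁵ - X⁶ - X⁹ + X¹⁰ + X¹³ + X¹⁴)`.) -/
theorem fekete_nineteen_mod_three_split : ∃ A B : (ZMod 3)[X],
    A * B = ∑ m ∈ Finset.range 19, C ((legendreSym 19 m : ℤ) : ZMod 3) * X ^ m ∧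
    A.support.card + B.support.card = 10 := by
  refine ⟨X + X ^ 4 - X ^ 9 - X ^ 12, 1 - X - X ^ 2 - X ^ 4 - X ^ 5 + X ^ 6, ?_, ?_⟩
  · rw [fekete_nineteen_mod_three_eq]
    have h3 : (3 : (ZMod 3)[X]) = 0 := by exact_mod_cast CharP.cast_eq_zero (ZMod 3)[X] 3
    have key : (X + X ^ 4 - X ^ 9 - X ^ 12 : (ZMod 3)[X]) * (1 - X - X ^ 2 - X ^ 4 - X ^ 5 + X ^ 6) =
        (X - X ^ 2 - X ^ 3 + X ^ 4 + X ^ 5 + X ^ 6 + X ^ 7 - X ^ 8 + X ^ 9 - X ^ 10 + X ^ 11 - X ^ 12 - X ^ 13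
          - X ^ 14 - X ^ 15 + X ^ 16 + X ^ 17 - X ^ 18)
        + 3 * (-X ^ 5 - X ^ 6 - X ^ 9 + X ^ 10 + X ^ 13 + X ^ 14) := by
      ring
    rw [key, h3, zero_mul, add_zero]
  · rw [card_support_A19, card_support_B19]

/-- **The signed mod-3 shadow of the line's bound is FALSE** (so the place of reduction must lie over `p`, and not
because the signs are lost): it is not true that for every prime `p ≠ 2` every factorisation of `F_p mod 3` in
`𝔽₃[X]` has support-sum `≥ (p+3)/2` (witness `p = 19`, support-sum `10`). -/
theorem not_feketeModThreeShadowBound :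
    ¬ ∀ (p : ℕ) [Fact p.Prime], p ≠ 2 → ∀ A B : (ZMod 3)[X],
        A * B = ∑ m ∈ Finset.range p, C ((legendreSym p m : ℤ) : ZMod 3) * X ^ m →
        (p + 3) / 2 ≤ A.support.card + B.support.card := by
  intro H
  obtain ⟨A, B, h, hcard⟩ := fekete_nineteen_mod_three_split
  have := H 19 (by norm_num) A B h
  omega

end Summit.ValiantsHypothesis.Theorems.FeketeNoSparseSplit.Negative
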